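import Summits.HodgeConjecture.HodgeConjecture.Theorems.NoetherLefschetzOneUpK3TypeNetsOddPrimeTranscendental
import Summits.HodgeConjecture.HodgeConjecture.Theorems.NoetherLefschetzOneUpK3TypeNetsSurfaceProductsHodge
import Literature.AlgebraicGeometry.Surfaces.K3HodgeTypesHolds
import Literature.AlgebraicGeometry.Surfaces.K3MarkingProofs
import Literature.AlgebraicGeometry.HodgeTheory.HypersurfaceHolomorphicFormsProofs
import Literature.AlgebraicGeometry.Surfaces.K3LatticeInvariants

/-!
# Products `S₁ × S₂` of surfaces with `p_g = 1` and transcendental lattices of different rank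

Crux `K3TypeNets` (stmt-HodgeConjecture-11600), product sector, third file of gen 48 (after
`…OddPrimeTranscendental` / `…OddPrimeSquares`). The gen-47 kernel criterion
`SurfaceProducts.hodgeConjectureFor_prod_of_hom_transcendental_eq_zero` ("`Hom_Hdg(T(S₂), T(S₁)) = 0 ⟹
HC(S₁ × S₂)`") is discharged by Schur's lemma: **for smooth projective complex surfaces `S₁`, `S₂` with
`h^{2,0} = 1` whose transcendental lattices have DIFFERENT ranks `b₂(S₁) − ρ(S₁) ≠ b₂(S₂) − ρ(S₂)`, every
Hodge morphism `T(S₂)_ℚ → T(S₁)_ℚ` vanishes (both are irreducible, Huybrechts Ch. 3 Lemma 3.1/2.7), so the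
Hodge conjecture holds for `S₁ × S₂`.** In particular for two complex projective K3 surfaces of different
Picard number (granted `b₂ = 22`).

* `Hom.toLinearMap_eq_zero_of_isIrreducible_of_finrank_ne` — Schur: a morphism between irreducible Hodge
  structures of different rank is zero (kernel and image are sub-Hodge structures);
* `exists_ratHom_of_isRationalClass` — descent of a rational `H²(S₂(ℂ); ℂ) → H²(S₁(ℂ); ℂ)` to `H²(–; ℚ)`;
* `hom_transcendental_eq_zero` — the hypothesis `hT₀` of the gen-47 criterion for such `S₁`, `S₂`;
* `hodgeConjectureFor_prod_of_finrank_ne` — **`HodgeConjectureFor 4 (S₁ ⊗ S₂)`**;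
  `hodgeConjectureFor_prod_of_isK3Surface_of_finrank_ne` (K3 surfaces),
  `hodgeConjectureFor_prod_of_isK3Surface_of_picard_ne` (different Picard numbers, modulo the named fact
  `K3_finrank_complexBetti_two`, `b₂ = 22`).

No definition, no named-fact hypothesis in the unconditional statements, no sorry. Prover seat ring2-b02
(gen 48).

References: D. Huybrechts, *Lectures on K3 Surfaces*, Ch. 3 Lemma 3.1, Lemma 2.7, §3.3 (Schur,
Lemma 3.3 / Cor. 3.6); D. Huybrechts, *Motives of isogenous K3 surfaces* (2019), §1; C. Voisin, *Hodge
Theory and Complex Algebraic Geometry I*, §7.3.1, §11.3.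
-/

set_option linter.dupNamespace false

noncomputable section

namespace Summit.HodgeConjecture.HodgeConjecture.Theorems.OddPrimeSquares

open scoped TensorProduct
open CategoryTheory MonoidalCategory Literature.AlgebraicGeometry Literature.AlgebraicGeometry.Motives
open Literature.AlgebraicGeometry.HodgeTheory Literature.AlgebraicTopology.SingularHomology
open Literature.AlgebraicGeometry.Motives.HodgeStructure Literature.AlgebraicGeometry.Surfaces

/-! ### Schur: morphisms between irreducible Hodge structures of different rank vanish -/

section Schur

universe u v

variable {V : Type u} [AddCommGroup V] [Module ℚ V] {W : Type v} [AddCommGroup W] [Module ℚ W] {n : ℤ}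

/-- **Schur's lemma for Hodge structures**: a morphism `φ : H₁ → H₂` between IRREDUCIBLE Hodge
structures on spaces of different (finite) dimension is zero — `ker φ` and `im φ` are sub-Hodge
structures (`Hom.exists_subHodgeStructure_ker/range`), so `φ` is `0` or injective with image `0` or
everything, and a bijection would match the dimensions. [cite: Huybrechts2016K3, Ch. 3 Lemma 3.3 and Cor. 3.6]
[cite: VoisinHodgeI2002, §7.3.1] -/
theorem Hom.toLinearMap_eq_zero_of_isIrreducible_of_finrank_ne [Module.Finite ℚ V] [Module.Finite ℚ W]
    {H₁ : HodgeStructure V n} {H₂ : HodgeStructure W n} (h₁ : H₁.IsIrreducible) (h₂ : H₂.IsIrreducible)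
    (hne : Module.finrank ℚ V ≠ Module.finrank ℚ W) (φ : Hom H₁ H₂) : φ.toLinearMap = 0 := by
  obtain ⟨K, hK⟩ := φ.exists_subHodgeStructure_ker
  rcases h₁.eq_bot_or_eq_top K with hbot | htop
  · -- injective: the image is `0` or everything
    have hinj : Function.Injective φ.toLinearMap := LinearMap.ker_eq_bot.1 (hK ▸ hbot)
    obtain ⟨R, hR⟩ := φ.exists_subHodgeStructure_range
    rcases h₂.eq_bot_or_eq_top R with hRbot | hRtop
    · exact LinearMap.range_eq_bot.1 (hR ▸ hRbot)
    · exfalso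
      have hsurj : Function.Surjective φ.toLinearMap := LinearMap.range_eq_top.1 (hR ▸ hRtop)
      exact hne (LinearEquiv.ofBijective φ.toLinearMap ⟨hinj, hsurj⟩).finrank_eq
  · exact LinearMap.ker_eq_top.1 (hK ▸ htop)

end Schur

variable {S₁ S₂ : SchemeOver ℂ}

/-- `H²_B(S)`: the weight-two `ℚ`-Hodge structure on `H²(S(ℂ); ℚ)` of the real Hodge model of `S`. -/
local notation3 "H²[" hS "]" =>
  bettiTwoHodgeStructure hS (BettiUniverse.realHodgeModel exists_isReal_hodgeModel_holds hS)
    (BettiUniverse.realHodgeModel_isHodgeSymmetric exists_isReal_hodgeModel_holds hS)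

/-- `T(S)_ℚ = Hdg¹^⊥ ⊆ H²(S(ℂ); ℚ)`. -/
local notation3 "T[" hS "]" =>
  transcendentalLatticeBetti hS (BettiUniverse.realHodgeModel exists_isReal_hodgeModel_holds hS)
    (BettiUniverse.realHodgeModel_isHodgeSymmetric exists_isReal_hodgeModel_holds hS)

/-- `Θ : ℂ ⊗_ℚ H²(S(ℂ); ℚ) → H²(S(ℂ); ℂ)`. -/
local notation3 "Θ[" S "]" => ofRatClassBaseChange (Motives.ComplexPoints S) (2 * 1)

/-! ### Descent of rational morphisms `H²(S₂(ℂ); ℂ) → H²(S₁(ℂ); ℂ)` -/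

/-- **A `ℂ`-linear map `H²(S₂(ℂ); ℂ) → H²(S₁(ℂ); ℂ)` preserving rational classes is the complexification
of a `ℚ`-linear map `H²(S₂(ℂ); ℚ) → H²(S₁(ℂ); ℚ)`** (pointwise preimages along the injective `a ↦ a ⊗ 1`).
[cite: HatcherAT2002, §3.1 p. 198] [cite: VoisinHodgeI2002, §7.1.1] -/
theorem exists_ratHom_of_isRationalClass (f : complexBetti S₂ (2 * 1) →ₗ[ℂ] complexBetti S₁ (2 * 1))
    (hf : ∀ y, IsRationalClass y → IsRationalClass (f y)) :
    ∃ g : bettiCohomology S₂ (2 * 1) →ₗ[ℚ] bettiCohomology S₁ (2 * 1),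
      (∀ v, ofRatClass (Motives.ComplexPoints S₁) (2 * 1) (g v) =
        f (ofRatClass (Motives.ComplexPoints S₂) (2 * 1) v)) ∧
      ∀ x, f (Θ[S₂] x) = Θ[S₁] (g.baseChange ℂ x) := by
  have hE : ∀ a : bettiCohomology S₂ (2 * 1), ∃ b : bettiCohomology S₁ (2 * 1),
      ofRatClass (Motives.ComplexPoints S₁) (2 * 1) b = f (ofRatClass (Motives.ComplexPoints S₂) (2 * 1) a) :=
    fun a ↦ by
      obtain ⟨b, hb⟩ := (isRationalClass_iff_mem_range_ofRatClass _).1 (hf _ (isRationalClass_ofRatClass a))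
      exact ⟨b, hb⟩
  choose t ht using hE
  have hinj := ofRatClass_injective (Y := Motives.ComplexPoints S₁) (2 * 1)
  let g : bettiCohomology S₂ (2 * 1) →ₗ[ℚ] bettiCohomology S₁ (2 * 1) :=
    { toFun := t
      map_add' := fun a b ↦ hinj (by rw [ht, map_add, map_add, map_add, ht, ht])
      map_smul' := fun q a ↦ hinj (by
        rw [ht, Motives.ofRatClass_smul, map_smul, RingHom.id_apply, Motives.ofRatClass_smul, ht]) }
  refine ⟨g, fun v ↦ ht v, fun x ↦ ?_⟩
  induction x using TensorProduct.induction_on with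
  | zero => simp only [map_zero]
  | tmul c a =>
    rw [ofRatClassBaseChange_tmul, map_smul, LinearMap.baseChange_tmul, ofRatClassBaseChange_tmul]
    exact congrArg (c • ·) (ht a).symm
  | add x y hx hy => rw [map_add, map_add, hx, hy, map_add, map_add]

/-! ### `Hom_Hdg(T(S₂), T(S₁)) = 0` for transcendental lattices of different rank -/

/-- **`Hom_Hdg(T(S₂), T(S₁)) = 0` when `h^{2,0}(S₁) = h^{2,0}(S₂) = 1` and `rk T(S₁) ≠ rk T(S₂)`** — the
hypothesis `hT₀` of `SurfaceProducts.hodgeConjectureFor_prod_of_hom_transcendental_eq_zero`: every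
`ℂ`-linear `f : H²(S₂(ℂ); ℂ) → H²(S₁(ℂ); ℂ)` preserving rational classes and Hodge types with image
cup-orthogonal to `N¹H²(S₁)` vanishes on `T(S₂) = (N¹H²(S₂))^⊥`. Proof: `f = Θ₁ (g ⊗ ℂ) Θ₂⁻¹`, `g` a
morphism `H²_B(S₂) → H²_B(S₁)` with `g(H²) ⊆ T(S₁)_ℚ`; its restriction `T(S₂)_ℚ → T(S₁)_ℚ` is a morphism
between irreducible Hodge structures (`exists_transcendental_subHodgeStructure`) of different rank
(`finrank_transcendentalLatticeBetti`), hence zero (`Hom.toLinearMap_eq_zero_of_isIrreducible_of_finrank_ne`).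
[cite: Huybrechts2016K3, Ch. 3 Lemma 3.1, Lemma 2.7 and Lemma 3.3] [cite: Huybrechts2019, §1] -/
theorem hom_transcendental_eq_zero (h₁ : IsSmoothProjective 2 S₁) (h₂ : IsSmoothProjective 2 S₂)
    {σ₁ : complexBetti S₁ (2 * 1)} (hσ₁ : IsOfHodgeType 2 S₁ (2 * 1) 2 0 σ₁) (hσ₁0 : σ₁ ≠ 0)
    (hline₁ : ∀ c : complexBetti S₁ (2 * 1), IsOfHodgeType 2 S₁ (2 * 1) 2 0 c → ∃ t : ℂ, c = t • σ₁)
    {σ₂ : complexBetti S₂ (2 * 1)} (hσ₂ : IsOfHodgeType 2 S₂ (2 * 1) 2 0 σ₂) (hσ₂0 : σ₂ ≠ 0)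
    (hline₂ : ∀ c : complexBetti S₂ (2 * 1), IsOfHodgeType 2 S₂ (2 * 1) 2 0 c → ∃ t : ℂ, c = t • σ₂)
    (hne : Module.finrank ℂ (complexBetti S₁ (2 * 1)) - Module.finrank ℂ (algebraicClasses S₁ 1) ≠
      Module.finrank ℂ (complexBetti S₂ (2 * 1)) - Module.finrank ℂ (algebraicClasses S₂ 1))
    (f : complexBetti S₂ (2 * 1) →ₗ[ℂ] complexBetti S₁ (2 * 1))
    (hf₁ : ∀ y, IsRationalClass y → IsRationalClass (f y))
    (hf₂ : ∀ (i j : ℕ) y, IsOfHodgeType 2 S₂ (2 * 1) i j y → IsOfHodgeType 2 S₁ (2 * 1) i j (f y))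
    (hf₄ : ∀ y : complexBetti S₂ (2 * 1), ∀ d ∈ algebraicClasses S₁ 1,
      cupProduct (rfl : 2 * 1 + 2 * 1 = 2 * 2) (f y) d = 0)
    (y : complexBetti S₂ (2 * 1))
    (hy : ∀ d ∈ algebraicClasses S₂ 1, cupProduct (rfl : 2 * 1 + 2 * 1 = 2 * 2) y d = 0) : f y = 0 := by
  haveI : Module.Finite ℚ (bettiCohomology S₁ (2 * 1)) := BettiUniverse.finite h₁ (2 * 1)
  haveI : Module.Finite ℚ (bettiCohomology S₂ (2 * 1)) := BettiUniverse.finite h₂ (2 * 1)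
  set M₁ := BettiUniverse.realHodgeModel exists_isReal_hodgeModel_holds h₁ with hM₁def
  set M₂ := BettiUniverse.realHodgeModel exists_isReal_hodgeModel_holds h₂ with hM₂def
  have hI := hodgePQ_independent_of_hodgeModel_holds
  have h4 : 2 * 1 + 2 * 1 = 2 * 2 := rfl
  -- (1) descend `f` to `g : H²(S₂(ℂ); ℚ) → H²(S₁(ℂ); ℚ)`
  obtain ⟨g, hgofRat, hg⟩ := exists_ratHom_of_isRationalClass f hf₁
  -- (2) `g` is a morphism of Hodge structures `H²_B(S₂) → H²_B(S₁)`
  have hgF : ∀ p : ℤ, ((H²[h₂]).F p).map (g.baseChange ℂ) ≤ (H²[h₁]).F p := by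
    intro p
    rintro _ ⟨x, hx, rfl⟩
    change x ∈ (BettiUniverse.hodge exists_isReal_hodgeModel_holds h₂ (2 * 1)).F p at hx
    change g.baseChange ℂ x ∈ (BettiUniverse.hodge exists_isReal_hodgeModel_holds h₁ (2 * 1)).F p
    rw [BettiUniverse.hodge_F, HodgeModel.ratF_eq_iSup] at hx ⊢
    induction hx using Submodule.iSup_induction' with
    | mem pq x hx =>
      by_cases hp' : p ≤ (pq.1.1 : ℤ)
      · rw [iSup_pos hp'] at hx
        refine Submodule.mem_iSup_of_mem pq (Submodule.mem_iSup_of_mem hp' ?_)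
        rw [HodgeModel.mem_ratPiece_iff, HodgeModel.complexification_apply] at hx ⊢
        have hx1 : IsOfHodgeType 2 S₂ (2 * 1) pq.1.1 pq.1.2 (Θ[S₂] x) := ⟨M₂, hx⟩
        have hx2 := hf₂ _ _ _ hx1
        rw [hg] at hx2
        obtain ⟨B, hB⟩ := hx2
        exact hI 2 S₁ h₁ B M₁ (2 * 1) _ _ _ hB
      · rw [iSup_neg hp', Submodule.mem_bot] at hx
        rw [hx, map_zero]
        exact Submodule.zero_mem _
    | zero => rw [map_zero]; exact Submodule.zero_mem _
    | add x y _ _ hx hy => rw [map_add]; exact Submodule.add_mem _ hx hy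
  let gH : Hom (H²[h₂]) (H²[h₁]) := ⟨g, hgF⟩
  -- (3) `g(H²) ⊆ T(S₁)_ℚ`
  have hN₁ : ∀ h ∈ (H²[h₁]).hodgeClasses 1,
      ofRatClass (Motives.ComplexPoints S₁) (2 * 1) h ∈ algebraicClasses S₁ 1 := fun h hh ↦ by
    rw [← map_hodgeClasses_baseChange_eq_algebraicClasses h₁]
    exact ⟨(1 : ℂ) ⊗ₜ h, Submodule.tmul_mem_baseChange_of_mem 1 hh,
      by rw [ofRatClassBaseChange_tmul, one_smul]⟩
  have hgT : ∀ v, g v ∈ T[h₁] := fun v ↦ by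
    rw [mem_transcendentalLatticeBetti_iff]
    intro h hh
    rw [cupPairingBetti_apply]
    have hc : cupProduct (X := Motives.ComplexPoints S₁) (R := ℚ) h4 h (g v) = 0 := by
      apply ofRatClass_injective (Y := Motives.ComplexPoints S₁) (2 * 2)
      rw [map_zero, ofRatClass_eq_ringChange, singularCohomology.ringChange_cupProduct,
        ← ofRatClass_eq_ringChange, ← ofRatClass_eq_ringChange, hgofRat,
        cupProduct_gradedComm_holds ℂ (Motives.ComplexPoints S₁) h4 h4, hf₄ _ _ (hN₁ h hh), smul_zero]
    rw [hc, map_zero]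
  -- (4) both transcendental lattices are irreducible, of different rank: the restriction vanishes
  obtain ⟨T₁, hT₁, hirr₁, -, -⟩ := exists_transcendental_subHodgeStructure h₁ hσ₁ hσ₁0 hline₁
  obtain ⟨T₂, hT₂, hirr₂, -, -⟩ := exists_transcendental_subHodgeStructure h₂ hσ₂ hσ₂0 hline₂
  have hgT' : ∀ v, g v ∈ T₁.toSubmodule := fun v ↦ by rw [hT₁]; exact hgT v
  let g' : Hom T₂.toHodgeStructure T₁.toHodgeStructure := (gH.comp T₂.subtypeHom).codRestrict T₁ fun t ↦ hgT' _
  have hrk : Module.finrank ℚ T₂.toSubmodule ≠ Module.finrank ℚ T₁.toSubmodule := by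
    rw [hT₁, hT₂, finrank_transcendentalLatticeBetti h₁, finrank_transcendentalLatticeBetti h₂]
    exact fun h ↦ hne h.symm
  have hzero := Hom.toLinearMap_eq_zero_of_isIrreducible_of_finrank_ne hirr₂ hirr₁ hrk g'
  have hgq : ∀ t : T₂.toSubmodule, g (t : bettiCohomology S₂ (2 * 1)) = 0 := by
    intro t
    have h1 := LinearMap.congr_fun hzero t
    have h2 : ((g'.toLinearMap t : T₁.toSubmodule) : bettiCohomology S₁ (2 * 1)) = g t := rfl
    rw [← h2, h1, LinearMap.zero_apply, Submodule.coe_zero]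
  -- (5) `y ⊥ N¹H²(S₂)` gives `Θ₂⁻¹ y ∈ T(S₂)_ℂ`, killed by `g ⊗ ℂ`
  obtain ⟨x, rfl⟩ := ofRatClassBaseChange_surjective h₂ (2 * 1) y
  have hxT : x ∈ T₂.toSubmodule.baseChange ℂ := by
    rw [hT₂, transcendentalLatticeBetti, baseChange_orthogonal_eq _ (cupPairingBetti_nondegenerate h₂),
      LinearMap.BilinForm.mem_orthogonal_iff]
    intro z hz
    apply cupPairingBetti_baseChange_eq_zero_of_cup h₂
    rw [cup_baseChange_eq_zero_iff]
    have hzN : Θ[S₂] z ∈ algebraicClasses S₂ 1 := by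
      rw [← map_hodgeClasses_baseChange_eq_algebraicClasses h₂]
      exact ⟨z, hz, rfl⟩
    rw [cupProduct_gradedComm_holds ℂ (Motives.ComplexPoints S₂) h4 h4, hy _ hzN, smul_zero]
  obtain ⟨u, rfl⟩ := hxT
  have hgx : g.baseChange ℂ (T₂.toSubmodule.subtype.baseChange ℂ u) = 0 := by
    clear hy
    induction u using TensorProduct.induction_on with
    | zero => rw [map_zero, map_zero]
    | tmul c t =>
      rw [LinearMap.baseChange_tmul, LinearMap.baseChange_tmul, Submodule.subtype_apply, hgq t,
        TensorProduct.tmul_zero]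
    | add u₁ u₂ e₁ e₂ => rw [map_add, map_add, e₁, e₂, add_zero]
  rw [hg, hgx, map_zero]

/-! ### The Hodge conjecture for `S₁ × S₂` -/

/-- **The Hodge conjecture for `S₁ × S₂`, `S₁`, `S₂` smooth projective complex surfaces with
`h^{2,0} = 1` and transcendental lattices of different rank `b₂(S₁) − ρ(S₁) ≠ b₂(S₂) − ρ(S₂)`** (in every
codimension, unconditionally): `Hom_Hdg(T(S₂), T(S₁)) = 0` (`hom_transcendental_eq_zero`) and the
marking-free Künneth bookkeeping `SurfaceProducts.hodgeConjectureFor_prod_of_hom_transcendental_eq_zero`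
(the Hodge classes of `S₁ × S₂` are then spanned by products of divisors and the fibre classes modulo
`N¹`). [cite: Huybrechts2016K3, Ch. 3 Lemma 3.1 and Lemma 3.3] [cite: Huybrechts2019, §1 and Cor. 0.4] -/
theorem hodgeConjectureFor_prod_of_finrank_ne (h₁ : IsSmoothProjective 2 S₁) (h₂ : IsSmoothProjective 2 S₂)
    {σ₁ : complexBetti S₁ (2 * 1)} (hσ₁ : IsOfHodgeType 2 S₁ (2 * 1) 2 0 σ₁) (hσ₁0 : σ₁ ≠ 0)
    (hline₁ : ∀ c : complexBetti S₁ (2 * 1), IsOfHodgeType 2 S₁ (2 * 1) 2 0 c → ∃ t : ℂ, c = t • σ₁)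
    {σ₂ : complexBetti S₂ (2 * 1)} (hσ₂ : IsOfHodgeType 2 S₂ (2 * 1) 2 0 σ₂) (hσ₂0 : σ₂ ≠ 0)
    (hline₂ : ∀ c : complexBetti S₂ (2 * 1), IsOfHodgeType 2 S₂ (2 * 1) 2 0 c → ∃ t : ℂ, c = t • σ₂)
    (hne : Module.finrank ℂ (complexBetti S₁ (2 * 1)) - Module.finrank ℂ (algebraicClasses S₁ 1) ≠
      Module.finrank ℂ (complexBetti S₂ (2 * 1)) - Module.finrank ℂ (algebraicClasses S₂ 1)) :
    HodgeConjectureFor 4 (S₁ ⊗ S₂) :=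
  SurfaceProducts.hodgeConjectureFor_prod_of_hom_transcendental_eq_zero h₁ h₂
    fun f hf₁ hf₂ _ hf₄ y hy ↦
      hom_transcendental_eq_zero h₁ h₂ hσ₁ hσ₁0 hline₁ hσ₂ hσ₂0 hline₂ hne f hf₁ hf₂ hf₄ y hy

/-- **The Hodge conjecture for the product of two complex projective K3 surfaces whose transcendental
lattices have different rank** (`b₂(S₁) − ρ(S₁) ≠ b₂(S₂) − ρ(S₂)`; for the tree's `IsK3Surface`, `h^{2,0} = 1`
by `IsK3Surface.twoZero_line` / `exists_isOfHodgeType_twoZero_ne_zero`).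
[cite: Huybrechts2016K3, Ch. 3 Lemma 3.1 and Ch. 1 (2.7)] [cite: Huybrechts2019, §1] -/
theorem hodgeConjectureFor_prod_of_isK3Surface_of_finrank_ne (hK₁ : IsK3Surface S₁) (hK₂ : IsK3Surface S₂)
    (hne : Module.finrank ℂ (complexBetti S₁ (2 * 1)) - Module.finrank ℂ (algebraicClasses S₁ 1) ≠
      Module.finrank ℂ (complexBetti S₂ (2 * 1)) - Module.finrank ℂ (algebraicClasses S₂ 1)) :
    HodgeConjectureFor 4 (S₁ ⊗ S₂) := by
  obtain ⟨σ₁, hσ₁0, hσ₁⟩ := hK₁.exists_isOfHodgeType_twoZero_ne_zero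
    (fun E _ _ _ M _ _ ↦ Voisin2002_closedForm_top_zero_not_exact_holds E M)
  obtain ⟨σ₂, hσ₂0, hσ₂⟩ := hK₂.exists_isOfHodgeType_twoZero_ne_zero
    (fun E _ _ _ M _ _ ↦ Voisin2002_closedForm_top_zero_not_exact_holds E M)
  exact hodgeConjectureFor_prod_of_finrank_ne hK₁.isSmoothProjective hK₂.isSmoothProjective hσ₁ hσ₁0
    (hK₁.twoZero_line hσ₁ hσ₁0) hσ₂ hσ₂0 (hK₂.twoZero_line hσ₂ hσ₂0) hne

/-- **Two K3 surfaces of different Picard number, granted `b₂ = 22`**: CONDITIONAL on the tree's named fact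
`K3_finrank_complexBetti_two` (`b₂(S) = 22` for K3 surfaces, Noether's formula; not yet discharged), the
Hodge conjecture holds for `S₁ × S₂` whenever `ρ(S₁) ≠ ρ(S₂)`.
[cite: Huybrechts2016K3, Ch. 1 §3.3 and Ch. 3 Lemma 3.1] [cite: Huybrechts2019, §1] -/
theorem hodgeConjectureFor_prod_of_isK3Surface_of_picard_ne (h22 : K3_finrank_complexBetti_two)
    (hK₁ : IsK3Surface S₁) (hK₂ : IsK3Surface S₂)
    (hne : Module.finrank ℂ (algebraicClasses S₁ 1) ≠ Module.finrank ℂ (algebraicClasses S₂ 1)) :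
    HodgeConjectureFor 4 (S₁ ⊗ S₂) := by
  haveI : Module.Finite ℂ (complexBetti S₁ (2 * 1)) := finite_complexBetti hK₁.isSmoothProjective (2 * 1)
  haveI : Module.Finite ℂ (complexBetti S₂ (2 * 1)) := finite_complexBetti hK₂.isSmoothProjective (2 * 1)
  have hρ₁ := Submodule.finrank_le (algebraicClasses S₁ 1)
  have hρ₂ := Submodule.finrank_le (algebraicClasses S₂ 1)
  refine hodgeConjectureFor_prod_of_isK3Surface_of_finrank_ne hK₁ hK₂ ?_
  change Module.finrank ℂ ↥(algebraicClasses S₁ 1) ≤ Module.finrank ℂ (complexBetti S₁ (2 * 1)) at hρ₁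
  change Module.finrank ℂ ↥(algebraicClasses S₂ 1) ≤ Module.finrank ℂ (complexBetti S₂ (2 * 1)) at hρ₂
  rw [h22 S₁ hK₁] at hρ₁ ⊢
  rw [h22 S₂ hK₂] at hρ₂ ⊢
  omega

end Summit.HodgeConjecture.HodgeConjecture.Theorems.OddPrimeSquares

end
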